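import Mathlib.Topology.ExtendFrom
import Literature.Analysis.FluidPDE.SereginSverakOffAxisRegularity
import Literature.Analysis.FluidPDE.SereginEpsilonRegularityGradient
import HarnessLib

/-!
# Seregin 2014, Ch. 6, Lemma 6.1: the case `k = 2` (`seregin2014_lemma61_gradient`) PROVED from the
# full lemma (`seregin2014_lemma61`)

Proofs-only file (no definitions, no named facts). The tree holds two renderings of G. Seregin,
*Lecture Notes on Regularity Theory for the Navier–Stokes Equations* (World Scientific 2014), Ch. 6,
§6.1, Lemma 6.1 (PDF p. 90) over the accepted class `IsSuitableWeakSolutionInBall 1 0`: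

* `seregin2014_lemma61` (`SereginEpsilonRegularityHigher.lean`): the full lemma — a representative
  of `U` on `Q(1/2)` with `C^∞` slices, all spatial derivatives Hölder continuous on `Q(1/2)` and
  bounded by absolute constants `c₀ k`;
* `seregin2014_lemma61_gradient` (`SereginEpsilonRegularityGradient.lean`): the case `k = 2` in
  weak-gradient form — every weak spatial gradient `G` of `U` on `Q` agrees a.e. on `Q(1/2)` with
  a field `W` Hölder continuous on the CLOSURE of `Q(1/2)` with `√|W|²_F < c₀₂` there (consumed by
  `SereginZajaczkowski2007Lemma23.lean`).

This file proves `seregin2014_lemma61_gradient_of_lemma61 : seregin2014_lemma61 →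
seregin2014_lemma61_gradient`, so that the trust base of both consumers collapses to the single
fact `seregin2014_lemma61` (as asked by the review of p22317). Ingredients:

* `holderOnWith_extendFrom_closure` (with `exists_tendsto_of_holderOnWith`,
  `norm_extendFrom_le_of_holderOnWith`): a Hölder continuous function (positive exponent) into a
  complete space extends to the closure of its domain with the same constant, exponent and bound
  (Mathlib's `extendFrom`; the limits exist because the image of `𝓝[s] x` is Cauchy);
* the classical gradient `D_x W₀` of the smooth representative is Hölder on `Q(1/2)` (it is the
  image of `D¹_x W₀` under the isometry `continuousMultilinearCurryFin1`) and bounded by `c₀ 1`;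
* `D_x W₀` is a weak spatial gradient of `W₀ = U` (a.e.) on `Q(1/2)` (accepted
  `SereginZajaczkowski2007.hasWeakSpatialGradientOn_fderiv`, `HasWeakSpatialGradientOn.congr_ae`),
  hence agrees a.e. with `G` there (accepted `HasWeakSpatialGradientOn.ae_eq`);
* `√|L|²_F ≤ √3 ‖L‖` (accepted `frobeniusNormSq_le_finrank_mul_sq_norm`), so `c₀₂ = √3 max(0, c₀ 1) + 1`
  works.

## References

* G. Seregin, *Lecture Notes on Regularity Theory for the Navier–Stokes Equations*, World
  Scientific 2014, Ch. 6, §6.1, Lemma 6.1 with (6.1.5)–(6.1.6) and Remark 6.1 (PDF p. 90).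
  [`Seregin2014`]
* L. Escauriaza, G. Seregin, V. Šverák, Russ. Math. Surveys 58:2 (2003), Lemma 2.2 (the same
  lemma). [`EscauriazaSereginSverak2003`]
-/

noncomputable section

open MeasureTheory Set Function Filter Topology TopologicalSpace Metric
open scoped NNReal ENNReal ContDiff

namespace Literature.Analysis.FluidPDE

/-! ### Hölder functions extend to the closure with the same constants -/

section HolderExtension

variable {X Y : Type*} [PseudoMetricSpace X] [MetricSpace Y] [CompleteSpace Y]
  {C r : ℝ≥0} {f : X → Y} {s : Set X}

/-- A Hölder continuous function on `s` (positive exponent) into a complete space has a limit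
within `s` at every point of the closure of `s` (uniform continuity makes the image of the filter
`𝓝[s] x` Cauchy). [folklore] -/
theorem exists_tendsto_of_holderOnWith (hf : HolderOnWith C r f s) (hr : 0 < r) {x : X}
    (hx : x ∈ closure s) : ∃ y, Tendsto f (𝓝[s] x) (𝓝 y) := by
  haveI : NeBot (𝓝[s] x) := mem_closure_iff_nhdsWithin_neBot.1 hx
  rw [← cauchy_map_iff_exists_tendsto, Metric.cauchy_iff]
  refine ⟨NeBot.map inferInstance f, fun ε hε => ?_⟩
  obtain ⟨δ, hδ, H⟩ := Metric.uniformContinuousOn_iff.1 (hf.uniformContinuousOn hr) ε hε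
  refine ⟨f '' (s ∩ ball x (δ / 2)), image_mem_map (inter_mem_nhdsWithin s (ball_mem_nhds x (half_pos hδ))),
    ?_⟩
  rintro _ ⟨a, ⟨has, ha⟩, rfl⟩ _ ⟨b, ⟨hbs, hb⟩, rfl⟩
  refine H a has b hbs ?_
  calc dist a b ≤ dist a x + dist x b := dist_triangle _ _ _
    _ < δ / 2 + δ / 2 := add_lt_add (mem_ball.1 ha) (by rw [dist_comm]; exact mem_ball.1 hb)
    _ = δ := by ring

/-- **Hölder extension to the closure.** A Hölder continuous function on `s` (positive exponent,
complete codomain) agrees on `s` with `extendFrom s f`, which is Hölder continuous ON THE CLOSURE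
of `s` with the same constant and exponent (pass to the limit in `dist (f a) (f b) ≤ C dist(a,b)^r`).
[folklore] -/
theorem holderOnWith_extendFrom_closure (hf : HolderOnWith C r f s) (hr : 0 < r) :
    HolderOnWith C r (extendFrom s f) (closure s) ∧ EqOn (extendFrom s f) f s := by
  have hlim : ∀ x ∈ closure s, Tendsto f (𝓝[s] x) (𝓝 (extendFrom s f x)) :=
    fun x hx => tendsto_extendFrom (exists_tendsto_of_holderOnWith hf hr hx)
  refine ⟨?_, extendFrom_extends (hf.continuousOn hr)⟩
  intro x hx y hy
  haveI : NeBot (𝓝[s] x) := mem_closure_iff_nhdsWithin_neBot.1 hx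
  haveI : NeBot (𝓝[s] y) := mem_closure_iff_nhdsWithin_neBot.1 hy
  -- the limit of `dist (f a) (f b) ≤ C dist(a, b)^r` along `𝓝[s] x ×ˢ 𝓝[s] y`
  have h1 : Tendsto (fun q : X × X => dist (f q.1) (f q.2)) (𝓝[s] x ×ˢ 𝓝[s] y)
      (𝓝 (dist (extendFrom s f x) (extendFrom s f y))) :=
    ((hlim x hx).comp tendsto_fst).dist ((hlim y hy).comp tendsto_snd)
  have hid : Tendsto (fun q : X × X => q) (𝓝[s] x ×ˢ 𝓝[s] y) (𝓝 (x, y)) := by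
    rw [nhds_prod_eq]
    exact Filter.prod_mono nhdsWithin_le_nhds nhdsWithin_le_nhds
  have h2 : Tendsto (fun q : X × X => (C : ℝ) * dist q.1 q.2 ^ (r : ℝ)) (𝓝[s] x ×ˢ 𝓝[s] y)
      (𝓝 ((C : ℝ) * dist x y ^ (r : ℝ))) := by
    have hd : Tendsto (fun q : X × X => dist q.1 q.2) (𝓝[s] x ×ˢ 𝓝[s] y) (𝓝 (dist x y)) :=
      (continuous_dist.tendsto (x, y)).comp hid
    exact (hd.rpow_const (Or.inr r.coe_nonneg)).const_mul _
  have hev : ∀ᶠ q : X × X in 𝓝[s] x ×ˢ 𝓝[s] y, dist (f q.1) (f q.2) ≤ (C : ℝ) * dist q.1 q.2 ^ (r : ℝ) := by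
    filter_upwards [prod_mem_prod self_mem_nhdsWithin self_mem_nhdsWithin] with q hq
    exact hf.dist_le hq.1 hq.2
  have hle : dist (extendFrom s f x) (extendFrom s f y) ≤ (C : ℝ) * dist x y ^ (r : ℝ) :=
    le_of_tendsto_of_tendsto h1 h2 hev
  -- back to the `edist` form
  rw [edist_dist, edist_dist, ← ENNReal.ofReal_coe_nnreal,
    ENNReal.ofReal_rpow_of_nonneg dist_nonneg r.coe_nonneg, ← ENNReal.ofReal_mul C.coe_nonneg]
  exact ENNReal.ofReal_le_ofReal hle

/-- A pointwise bound `‖f‖ ≤ M` on `s` passes to `extendFrom s f` on the closure of `s`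
(normed codomain). [folklore] -/
theorem norm_extendFrom_le_of_holderOnWith {Y' : Type*} [NormedAddCommGroup Y'] [CompleteSpace Y']
    {f : X → Y'} (hf : HolderOnWith C r f s) (hr : 0 < r) {M : ℝ} (hM : ∀ a ∈ s, ‖f a‖ ≤ M)
    {x : X} (hx : x ∈ closure s) : ‖extendFrom s f x‖ ≤ M := by
  haveI : NeBot (𝓝[s] x) := mem_closure_iff_nhdsWithin_neBot.1 hx
  have hlim : Tendsto f (𝓝[s] x) (𝓝 (extendFrom s f x)) :=
    tendsto_extendFrom (exists_tendsto_of_holderOnWith hf hr hx)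
  exact le_of_tendsto hlim.norm (eventually_mem_nhdsWithin.mono hM)

end HolderExtension

/-! ### The case `k = 2` from the full lemma -/

/-- `√(|L|²_F) ≤ √3 ‖L‖` for a linear map of `ℝ³` (`|L|²_F ≤ 3 ‖L‖²`, accepted
`frobeniusNormSq_le_finrank_mul_sq_norm`). [folklore] -/
theorem sqrt_frobeniusNormSq_le_sqrt_three_mul_norm (L : EuclideanSpace ℝ (Fin 3) →L[ℝ] EuclideanSpace ℝ (Fin 3)) :
    Real.sqrt (frobeniusNormSq L) ≤ Real.sqrt 3 * ‖L‖ := by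
  have h := frobeniusNormSq_le_finrank_mul_sq_norm L
  rw [finrank_euclideanSpace_fin] at h
  push_cast at h
  calc Real.sqrt (frobeniusNormSq L) ≤ Real.sqrt (3 * ‖L‖ ^ 2) := Real.sqrt_le_sqrt h
    _ = Real.sqrt 3 * ‖L‖ := by
        rw [Real.sqrt_mul (by norm_num), Real.sqrt_sq (norm_nonneg _)]

/-- **Seregin 2014, Ch. 6, Lemma 6.1, case `k = 2` (`seregin2014_lemma61_gradient`) PROVED from the
full lemma (`seregin2014_lemma61`).** With the constants `ε₀` and `c₀₂ = √3 max(0, c₀ 1) + 1`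
(`c₀ 1` the bound of `seregin2014_lemma61` for the first derivatives): for a suitable pair in `Q`
with (6.1.5) and a weak spatial gradient `G` of `U` on `Q`, the smooth representative `W₀` of `U`
on `Q(1/2)` has its classical gradient `D_x W₀` Hölder continuous on `Q(1/2)` with
`‖D_x W₀‖ ≤ c₀ 1`; being Hölder, `D_x W₀` extends to the closure of `Q(1/2)` with the same
constants and bound (`holderOnWith_extendFrom_closure`); `D_x W₀` is a weak spatial gradient of
`W₀`, hence of `U`, on `Q(1/2)` (accepted `hasWeakSpatialGradientOn_fderiv`,
`HasWeakSpatialGradientOn.congr_ae`), so `G = D_x W₀` a.e. there (accepted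
`HasWeakSpatialGradientOn.ae_eq`); and `√(|·|²_F) ≤ √3 ‖·‖ < c₀₂`.
[cite: Seregin2014, Ch. 6 §6.1 Lemma 6.1 ((6.1.5)–(6.1.6), case k = 2), PDF p. 90] -/
theorem seregin2014_lemma61_gradient_of_lemma61 (h : seregin2014_lemma61) :
    seregin2014_lemma61_gradient := by
  obtain ⟨ε₀, hε₀, c₀, H⟩ := h
  refine ⟨ε₀, Real.sqrt 3 * max 0 (c₀ 1) + 1, hε₀, by positivity, ?_⟩
  intro U P G hU hG hsmall
  obtain ⟨W₀, hUW, hcd, hk⟩ := H U P hU hsmall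
  obtain ⟨C₁, α₁, hα₁, hH₁⟩ := (hk 1).1
  have hb₁ := (hk 1).2
  obtain ⟨C₀', α₀, hα₀, hH₀⟩ := (hk 0).1
  set S : Set (ℝ × EuclideanSpace ℝ (Fin 3)) := parabolicCylinder (1 / 2) (0 : ℝ × EuclideanSpace ℝ (Fin 3)) with hS
  have hSo : IsOpen S := isOpen_parabolicCylinder _ _
  -- the classical gradient `F = D_x W₀` is Hölder on `S` and bounded by `c₀ 1`
  set F : ℝ × EuclideanSpace ℝ (Fin 3) → (EuclideanSpace ℝ (Fin 3) →L[ℝ] EuclideanSpace ℝ (Fin 3)) :=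
    fun z => fderiv ℝ (W₀ z.1) z.2 with hF
  have hFeq : F = (continuousMultilinearCurryFin1 ℝ (EuclideanSpace ℝ (Fin 3)) (EuclideanSpace ℝ (Fin 3))) ∘
      fun w : ℝ × EuclideanSpace ℝ (Fin 3) => iteratedFDeriv ℝ 1 (W₀ w.1) w.2 := by
    funext w
    ext1 v
    simp only [hF, comp_apply, continuousMultilinearCurryFin1_apply, iteratedFDeriv_one_apply]
    rfl
  have hiso := (continuousMultilinearCurryFin1 ℝ (EuclideanSpace ℝ (Fin 3)) (EuclideanSpace ℝ (Fin 3))).lipschitz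
  have hFH : HolderOnWith (1 * C₁ ^ ((1 : ℝ≥0) : ℝ)) (1 * α₁) F S := by
    rw [hFeq]
    exact (holderWith_one.2 hiso).comp_holderOnWith hH₁
  have hα : 0 < 1 * α₁ := by positivity
  have hFb : ∀ z ∈ S, ‖F z‖ ≤ max 0 (c₀ 1) := by
    intro z hz
    rw [hFeq, comp_apply, LinearIsometryEquiv.norm_map]
    exact (hb₁ z hz).trans (le_max_right _ _)
  -- its Hölder extension `W` to the closure
  obtain ⟨hWH, hWF⟩ := holderOnWith_extendFrom_closure hFH hα
  refine ⟨extendFrom S F, _, _, hα, hWH, ?_, ?_⟩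
  · -- `G = F = W` a.e. on `S`, by uniqueness of weak spatial gradients
    have hle : parabolicCylinderOpens (1 / 2) (0 : ℝ × EuclideanSpace ℝ (Fin 3)) ≤
        parabolicCylinderOpens 1 (0 : ℝ × EuclideanSpace ℝ (Fin 3)) :=
      prod_mono (Ioo_subset_Ioo (by norm_num) le_rfl) (ball_subset_ball (by norm_num))
    have hG' : HasWeakSpatialGradientOn (parabolicCylinderOpens (1 / 2) (0 : ℝ × EuclideanSpace ℝ (Fin 3))) W₀ G :=
      (hG.mono hle).congr_ae hUW
    have h0 : ContinuousOn (uncurry W₀) S := SereginSverak2009.continuousOn_uncurry_of_holder hα₀ hH₀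
    have hGF : HasWeakSpatialGradientOn (parabolicCylinderOpens (1 / 2) (0 : ℝ × EuclideanSpace ℝ (Fin 3))) W₀
        fun t x => fderiv ℝ (W₀ t) x :=
      SereginZajaczkowski2007.hasWeakSpatialGradientOn_fderiv h0 (hFH.continuousOn hα)
        fun z hz => (hcd z hz).differentiableAt (by simp)
    have hae := hG'.ae_eq hGF
    filter_upwards [hae, ae_restrict_mem hSo.measurableSet] with z hz hzS
    rw [hz]
    exact (hWF hzS).symm
  · -- the bound `√|W|² < √3 max(0, c₀ 1) + 1` on the closure
    intro z hz
    have hn : ‖extendFrom S F z‖ ≤ max 0 (c₀ 1) := norm_extendFrom_le_of_holderOnWith hFH hα hFb hz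
    calc Real.sqrt (frobeniusNormSq (extendFrom S F z)) ≤ Real.sqrt 3 * ‖extendFrom S F z‖ :=
          sqrt_frobeniusNormSq_le_sqrt_three_mul_norm _
      _ ≤ Real.sqrt 3 * max 0 (c₀ 1) := mul_le_mul_of_nonneg_left hn (Real.sqrt_nonneg _)
      _ < Real.sqrt 3 * max 0 (c₀ 1) + 1 := lt_add_one _

end Literature.Analysis.FluidPDE

end
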